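import Mathlib
import HarnessLib
import HarnessLib.Audit
import Summits.Parity.Statement

/-!
Route: CubicRoots

CLOSED (retired) 2026-08-15T13:49:38Z by operator:999:1257524 — reason: not-a-thesis: assembly does not conclude the sub-problem Statement — note: D-0027 §2.1 audit (human 2026-08-15: routes that do not decide the summit are removed): the assembly concludes `CubicBH`, not the sub-problem statement; a NEW conforming route may be opened from the same idea (generated `closes : … → _root_.BatemanHorn`).. The file is kept as the record of this route; refuted decls are indexed as negative knowledge (`ledger negatives`).

X_CR (CubicRoots). Target: BatemanHorn for a single irreducible CUBIC f (decl CubicBH: ∀ f,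
natDegree f = 3 → IsBatemanHornSystem ![f] → BatemanHornAsymptotic ![f]) — the first degree where
the parity window is wide: divisor pairs d·e = f(n) ≍ x³ with min(d, e) ∈ [x^{1−η}, x^{3/2}],
typically both cofactors ≫ x, so that A_d(x) = #{n ≤ x : d | f(n)} counts SMALL roots ν ≤ x < d of a
cubic congruence and no complete residue system is ever summed. It suffices to show the cubic Möbius
tail
  CubicMobiusTail: ∃ η ∈ (0,1): ∑_{n≤x} ∑_{d | f(n), d > x^{1−η}} μ(d) log d = o(x)
(= PolyMobiusTail of route PolynomialMobius at k = 1, deg 3); the theorem-grade glue TypeIMainTerm ∧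
LambdaToCount (shared verbatim with PolynomialMobius) then yields CubicBH. The content of the route
is the INPUT it proposes for the tail. By Dedekind–Kummer the roots ν mod d of f (d prime to the
index) are the degree-one ideals of norm d in ℤ[α], f(α) = 0, i.e. lattice points on ONE periodic
torus orbit of the cubic field in SL₃(ℤ)\SL₃(ℝ) read at height log d, and ν/d mod 1 is a
horospherical (Hermite-normal-form) coordinate of that point: [Welsh2022] parametrises roots of
polynomial congruences this way in every degree, [EinsiedlerLindenstraussMichelVenkatesh2011] proves
equidistribution of the cubic torus orbits themselves, and in degree 2 the same dictionary
(geodesics on the modular surface) gives the fine-scale statistics of roots [MarklofWelsh2023]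
behind [Hooley1964]/[DukeFriedlanderIwaniec1995]/[Toth2000]. So the two missing Type-I inputs for
cubics — roots equidistributed modulo PRIMES (crux CubicRootsPrimeModuli; the quadratic case is the
DFI theorem) and a POWER SAVING over all moduli (crux CubicHooleyPowerSaving; Hooley 1964 saves only
(log D)^{-δ} for deg ≥ 3) — become effective-equidistribution problems for higher-rank
diagonal/unipotent dynamics on a fixed torus orbit; a second, probabilistic import is CRT mixing
[KowalskiSoundararajan2021], which recovers Hooley for all f over composite moduli and isolates what
prime moduli must supply. The parity content proper is the balanced atom CubicBalancedMobius (μ(d)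
over divisors d ∈ (x^{3/2}, 2x^{3/2}] of f(n), n ≤ x).
Lean (X_CR = decl CubicMobiusTail; elaborates):
∀ f : Polynomial ℤ, f.natDegree = 3 → Literature.NumberTheory.Sieve.IsBatemanHornSystem ![f] → ∃ η :
ℝ, 0 < η ∧ η < 1 ∧ (fun x : ℕ => ∑ n ∈ Finset.Icc 1 x, ∑ d ∈ ((f.eval (n : ℤ)).toNat).divisors, if
(x : ℝ) ^ (1 - η) < (d : ℝ) then (ArithmeticFunction.moebius d : ℝ) * Real.log d else 0)
=o[Filter.atTop] fun x : ℕ => (x : ℝ)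

Rationale: WHY THIS LINE (brief = widen: homogeneous dynamics in higher rank + probabilistic CRT mixing). Every
existing Parity route is linear or quadratic where it is precise (QuadraticRoots: GL₂/Kloosterman
for n²+1; MinorArcs r3: n²+1; UnimodularColumns: discriminant −4). For deg f = 3 the two Type-I
inputs that made the quadratic case move — equidistribution of roots to PRIME moduli
[DukeFriedlanderIwaniec1995] and POWER-saving equidistribution over all moduli (Hooley 1963, via
Weil/Kloosterman) — are both missing: [Hooley1964] gives a (log D)^{-δ} saving for deg ≥ 3, prime
moduli are open. The harmonic analysis is no longer on GL₂: [Welsh2022] places the roots on a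
periodic torus orbit of the cubic field inside SL₃(ℤ)\SL₃(ℝ); equidistribution of these orbits as
the field varies is [EinsiedlerLindenstraussMichelVenkatesh2011]; effective equidistribution of
horospherical coordinates sampled along a FIXED torus orbit at increasing height is the dynamics
problem this route poses. Imported: measure rigidity / effective mixing for higher-rank diagonal
actions and the spectral gap of SL₃(ℤ)\SL₃(ℝ); CRT mixing [KowalskiSoundararajan2021] for composite
moduli; the deg-2 template [MarklofWelsh2023], [Toth2000].
RANKED CRUXES.
 r2 CubicBalancedMobius: ∀ cubic BH f: ∑_{n≤x} ∑_{d | f(n), x^{3/2} < d ≤ 2x^{3/2}} μ(d) = o(x)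
(balanced parity atom: both cofactors ≍ x^{3/2} ≫ x; ≍ x terms since ∑_{n≤x} τ(f(n)) ≍ x log x
spread over ≍ log x dyadic scales; numerically testable).
 r3 CubicRootsPrimeModuli: ∀ irreducible cubic f, h ≠ 0: ∑_{p≤P} ∑_{f(ν)≡0 (p)} e(hν/p) = o(P/log P)
(deg 2 = DFI theorem; open for deg 3; the Type-I input for prime d > x).
 r4 CubicHooleyPowerSaving: over all d ≤ D with a power saving O(D^{1−δ}) (Hooley 1964: qualitative
only for deg ≥ 3; a spectral-gap proof would give δ > 0; grounders: confirm no power saving is in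
print for cubics).
 r5 CubicMobiusTail (X_CR; the deg-3, k = 1 case of PolynomialMobius r2, filed so the cubic Assembly
is self-contained).
 target r0 CubicBH. support r9 shared with PolynomialMobius: TypeIMainTerm, LambdaToCount.
 r1 Assembly: CubicMobiusTail → TypeIMainTerm → LambdaToCount → CubicBH (specialise k = 1, f = ![f];
provable).
KILL CRITERIA. r3 refuted (a cubic whose roots mod p are provably NOT equidistributed) contradicts
the Chebotarev/Sato–Tate-type expectation and closes the Type-I programme of the route; r4 refuted
for some (f, h) (Ω(D^{1−ε}) for every ε) demotes the dynamics import to qualitative — pivot to r3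
only; r2 refuted (Ω(x) along a cubic) refutes CubicMobiusTail in its balanced range ⇒ with the glue
proved, ¬CubicBH ⇒ ¬BatemanHorn: file it and close. If PolynomialMobius r2 is PROVED in general,
close as subsumed.
NOT DECOMPOSED YET. r3 ∧ r4 ⇒ signed Type-I for A_d(x), d ∈ [x, x^{2+η}] (needs JOINT fine-scale
equidistribution of (ν/d, d) at scale x/d, the rank-2 analogue of Marklof–Welsh); the
cofactor/bilinear side e ∈ [x^{1−η}, x^{3/2}]; deg ≥ 4 (torus orbits in SL_g); k ≥ 2.

Novelty: NOVELTY (retriage 2026-08-14; lit search/frontier/bridges + lean search run). Nearest prior art: (1)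
Hooley1978CubicPrimeFactor = doi:10.1515/crll.1978.303-304.21 (+ Hooley 1976 tract pp.39-40): roots
of v^3 = 2 (mod l) <-> primitive representations by the norm form x^3+2y^3+4z^3-6xyz of Q(cbrt 2) —
the route's roots = ideals = torus-orbit-points dictionary in classical dress; Weyl sums ->
incomplete Kloosterman sums of length ~q^{1/3}, power saving only under Hypothesis R*. (2)
HeathBrown2001LargestPrimeFactorCubic = doi:10.1112/plms/82.3.554, arXiv:1412.0024: same
parametrisation + q-van der Corput = the only unconditional Type-I input for a cubic beyond d <= x
(level x^{1+1e-303}, n^3+2). (3) Welsh2018CubicCongruenceSpacing = arXiv:1809.05211, Welsh2022: the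
SL3(Z)\SL3(R) reformulation, warning that root matrices meet a thin set of unipotent cosets (no
Poincare series); spacing + large sieve only. (4) KowalskiSoundararajan2021 Conj. A.2 = crux r3
verbatim; CRT mixing re-proves Hooley1964 softly. (5) DukeFriedlanderIwaniec1995, Toth2000,
MarklofWelsh2023: the deg-2 template. Delta: none of (1)-(5) reaches mu(d) over divisors d > x of
f(n); the route combines Hooley's torus-orbit parametrisation with EFFECTIVE higher-rank dynamics on
a FIXED orbit (EinsiedlerLindenstraussMichelVenkatesh2011 is qualitative, varies the field) and CRT
mixing to feed a Mobius-tail split of Lambda(f(n)) for a cubic — a new combination; the balanced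
atom r2 (d ~ x^{3/2}) has no print counterpart.  [refs: 10.1515/crll.1978.303-304.21, 10.1112/plms/82.3.554, 1412.0024, 1809.05211, doi:10.1515/crll.1978.303-304.21, doi:10.1112/plms/82.3.554, Welsh2022, KowalskiSoundararajan2021, Hooley1964, DukeFriedlanderIwaniec1995, Toth2000, MarklofWelsh2023, EinsiedlerLindenstraussMichelVenkatesh2011]

Barriers (technique_class: SL3-dynamics spectral-gap type-I type-II bilinear-forms): BARRIERS (Literature/Barriers/Parity/, 25 entries read; technique_class: SL3-dynamics spectral-gap
type-I type-II bilinear-forms).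
- Literature.Barriers.Parity.FordMaynardLowLevel: APPLIES squarely — cubic values are thin (c =
2/3): Type-I level <= x = N^{1/3} of N ~ x^3 and no Type-II range with theta < 1/2
(FordMaynard2024PrimeSieves §2.4): C^- = 0 for every classical Type-I/II scheme. Not evaded; the
bet: root equidistribution to moduli d in [x, x^{2+eta}] (r3, r4 + joint fine-scale versions) is
Type-I information BEYOND level x (HeathBrown2001LargestPrimeFactorCubic reaches x^{1+1e-303} for
n^3+2).
- Literature.Barriers.Parity.SelbergParityBarrier: APPLIES to Type-I-only derivations at any level;
parity is internalised as SIGNED Mobius statements (X_CR, atom r2) that Selberg's 1 +- lambda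
examples do not obstruct — open, not evaded.
- Literature.Barriers.Parity.FordFixedLevelBarrier: APPLIES — TypeIMainTerm stops at x^{1-eta};
Ford2004 Thm 1 is why the complement X_CR is BH-strength (item 0880, now kind target). Named, not
evaded.
- Literature.Barriers.Parity.FordMaynardMinimalTypeII: APPLIES to the undecomposed cofactor side e
in [x^{1-eta}, x^{3/2}]; no Type-II estimate for cubic values exists at any width. Not evaded.
- Literature.Barriers.Parity.LinearSieveOptimality: no sieve weights are used (exact Lambda =
-mu*log split at x^{1-eta}), so (ii) is moot and (i) = SelbergParityBarrier.
- Literature.Barriers.Parity.FunctionFieldMobiusBias (germane, no shared token): X_C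

History (route lifecycle, newest last):
- 2026-08-15T13:49:38Z · CLOSED retired — not-a-thesis: assembly does not conclude the sub-problem Statement (operator:999:1257524)

sub-problem: BatemanHorn · status: closed(retired) · opened planner-plan-Parity-BatemanHorn-0 2026-08-13T19:23:12Z · rev 2 · ledger route-Parity-CubicRoots
GENERATED by the gate from the ledger (D-0016/17). Provers cite these decls: `theorem foo : Summit.Parity.BatemanHorn.Theses.CubicRoots.<Decl> := …` in Summits/Parity/BatemanHorn/Theorems/<Name>.lean.
-/

namespace Summit.Parity.BatemanHorn.Theses.CubicRoots

open scoped BigOperators Topology Manifold Classical MeasureTheory ProbabilityTheory Matrix InnerProductSpace ComplexConjugate ContinuousMap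
open Filter Set Function TopologicalSpace MeasureTheory

attribute [summit_statement] _root_.BatemanHorn

/-- item stmt-Parity-0876 · target · rank 0 · closed · moot by None · by planner
why it might fail: Open: no one-variable polynomial of degree ≥ 2 is known to take infinitely many prime values (nearest theorems are two-variable: x³+2y³, a²+b⁴). False only if BH fails for a cubic — which DOES happen verbatim over F_q[u] (Conrad–Conrad–Gross Möbius bias), so ℤ-specific input is needed.
sources: BatemanHorn1962, (1) (the conjecture; CubicBH = k=1, deg-3 slice of Literature.NumberTheory.Sieve.BatemanHornConjecture), HeathBrownActa2001 (x³+2y³: two-variable analogue only), ConradConradGross2008, Ex. 1.1–1.2 = Literature.Barriers.Parity.FunctionFieldMobiusBias, Irving2014LargestPrimeFactorCubic = arXiv:1412.0024, p.3 (for n³+2 only a large prime factor, P > x^{1+1e-52})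
[target] Bateman–Horn for one irreducible cubic: ∀ f ∈ ℤ[X], natDegree f = 3 → IsBatemanHornSystem
![f] → BatemanHornAsymptotic ![f] (#{n ≤ x : f(n) prime} ~ C(f)/3 · x/log x). The k = 1, deg 3 slice
of the conjunct BatemanHorn; no cubic case is known (Heath-Brown's x³+2y³ [HeathBrownActa2001] is
the two-variable analogue). -/
@[route_item "route-Parity-CubicRoots"]
def CubicBH : Prop :=
  ∀ f : Polynomial ℤ, f.natDegree = 3 → Literature.NumberTheory.Sieve.IsBatemanHornSystem ![f] → Literature.NumberTheory.Sieve.BatemanHornAsymptotic ![f]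

/-- item stmt-Parity-0877 · crux · rank 2 · closed · moot by None · by planner
why it might fail: Divisors d≍x^{3/2}>x of cubic values lie beyond every Type-I/II range in print: #{n≤x: d|f(n)} has an asymptotic only for d≤x (Irving 2014 p.3; Heath-Brown 2001: x^{1+1e-303}, n³+2 only); even Στ(f(n)) has no asymptotic for deg 3 (Erdős 1952). False only via a CCG-type μ-bias; none seen to 2.56e5.
sources: Irving2014LargestPrimeFactorCubic = arXiv:1412.0024, p.3 ('asymptotic for #{n: d | n³+2} only when d ≤ X'), HeathBrown2001LargestPrimeFactorCubic = doi:10.1112/plms/82.3.554, Thm 1 (level X^{1+1e-303}, X³+2, positive proportion of n), Erdős, J. London Math. Soc. 27 (1952) 7–15, 'On the sum Σ d(f(k))': x log x ≪ Σ_{n≤x} τ(f(n)) ≪ x log x, asymptotic open for irreducible deg ≥ 3, ConradConradGross2008, Ex. 1.1/3.2 (μ(f(g)) = −1 twice as often: the only known mechanism for a Möbius bias along polynomial values) = Literature.Barriers.Parity.FunctionFieldMobiusBias, Literature.NumberTheory.Sieve.hooley_polyRoots_logPowerSaving_holds (tree, Hooley1964 via DartygeMartin2019 Lemma 5): root equidistribution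 gives no access to μ(d), d > x, refuter numerics on stmt-Parity-0877 (g28-4/5/6, 2026-08-13): #terms ≈ 0.2–0.3x, |S| ≈ √#terms to x = 2.56e5
[crux] Balanced parity atom for cubics: for every cubic BH system f, ∑_{n≤x} ∑_{d | f(n), x^{3/2} <
d ≤ 2x^{3/2}} μ(d) = o(x). Both cofactors d, f(n)/d ≍ x^{3/2} ≫ x, so d | f(n) with n ≤ x < d is a
small-root event; ≍ x terms in total (∑_{n≤x} τ(f(n)) ≍ x log x over ≍ log x dyadic scales). Open
(parity); numerically testable. Sources: Hooley1964, Welsh2022 (roots ↔ ideals of ℤ[α] ↔ torus-orbit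
points). -/
@[route_item "route-Parity-CubicRoots"]
def CubicBalancedMobius : Prop :=
  ∀ f : Polynomial ℤ, f.natDegree = 3 → Literature.NumberTheory.Sieve.IsBatemanHornSystem ![f] → (fun x : ℕ => ∑ n ∈ Finset.Icc 1 x, ∑ d ∈ ((f.eval (n : ℤ)).toNat).divisors, if (x : ℝ) ^ (3 / 2 : ℝ) < (d : ℝ) ∧ (d : ℝ) ≤ 2 * (x : ℝ) ^ (3 / 2 : ℝ) then (ArithmeticFunction.moebius d : ℝ) else 0) =o[Filter.atTop] fun x : ℕ => (x : ℝ)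

/-- item stmt-Parity-0878 · crux · rank 3 · closed · moot by None · by planner
why it might fail: = KS2021 Conj. A.2 at deg 3, open since DFI95: the deg-2 proof needs roots↔binary quadratic forms↔Poincaré series on Γ₀(d)\H + Kloosterman; cubic root matrices fill a thin set of cosets of N\SL₃(ℤ) (Welsh 2018: SL₃ hope 'may have been misplaced'); ELMV ineffective, varies the field. f non-monic too.
sources: KowalskiSoundararajan2021 = arXiv:2003.12965, Conj. A.2 (held render: Conj. 8.2 p.18) and p.3 'remains an outstanding open problem', DukeFriedlanderIwaniec1995 + Toth2000 = Literature.NumberTheory.Sieve.dukeFriedlanderIwaniecToth_quadraticRoots_primeModuli (tree fact, natDegree = 2 only), Welsh2018CubicCongruenceSpacing = arXiv:1809.05211, pp.3–4 (thin unipotent cosets; no Poincaré series for cubic roots; spacing/large sieve only), EinsiedlerLindenstraussMichelVenkatesh2011 = arXiv:0708.1113 (Duke's theorem for cubic fields: ineffective, discriminant → ∞, not a fixed orbit), Welsh2022 = arXiv:2008.00538 p.3 ('much less is known … d ≥ 3'); Welsh 2025 arXiv:2509.00898 p.3 (congruence roots themselves still out of reach), Foo, Acta Arith. 144 (2010) doi:10.4064/aa144-1-1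 (even density of {ν/p} for deg ≥ 3 known only conditionally on Bouniakowsky)
[crux] Roots of an irreducible cubic are equidistributed modulo primes: ∀ f ∈ ℤ[X] irreducible of
degree 3, ∀ h ≠ 0, ∑_{p ≤ P} ∑_{ν mod p, f(ν) ≡ 0} e(hν/p) = o(P/log P) (∑_{p≤P} ω_f(p) ~ P/log P by
the prime ideal theorem, so this is Weyl's criterion). Degree 2 is the Duke–Friedlander–Iwaniec
theorem (DukeFriedlanderIwaniec1995; Toth2000 all quadratics); degree ≥ 3 is open. The Type-I input
for prime moduli d > x in the cubic window. Imported attack: Welsh2022 parametrisation + effective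
equidistribution on SL₃(ℤ)\SL₃(ℝ) (EinsiedlerLindenstraussMichelVenkatesh2011). -/
@[route_item "route-Parity-CubicRoots"]
def CubicRootsPrimeModuli : Prop :=
  ∀ f : Polynomial ℤ, f.natDegree = 3 → Irreducible f → ∀ h : ℤ, h ≠ 0 → (fun P : ℕ => ∑ p ∈ Nat.primesLE P, ∑ ν ∈ (Finset.range p).filter (fun ν : ℕ => (p : ℤ) ∣ f.eval (ν : ℤ)), Complex.exp (2 * Real.pi * Complex.I * (h * ν / p : ℂ))) =o[Filter.atTop] fun P : ℕ => ((P : ℝ) / Real.log P : ℝ)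

/-- item stmt-Parity-0879 · crux · rank 4 · closed · moot by None · by planner
why it might fail: Stronger than print: Hooley 1964 saves (log D)^{-(3-√3)/6} via Σ_d|S_f(h,d)| ≥ π(D), so D^{1-δ} needs cancellation ACROSS moduli; the one engine (Hooley 1978 norm forms) ends in Kloosterman sums of length q^{1/3}: power saving only under R* (Heath-Brown 2001: factorable q); no SL₃ Poincaré series.
sources: Literature.NumberTheory.Sieve.hooley_polyRoots_logPowerSaving_holds (tree; Hooley1964 as DartygeMartin2019 = arXiv:1802.09090 Lemma 5: saving (log D)^{-δ_n}, δ_3 = (3−√3)/6, proved via Σ|S_f(h,d)|), Hooley1978CubicPrimeFactor = doi:10.1515/crll.1978.303-304.21 (ν³≡2: Weyl sums → short Kloosterman sums, conditional on Hypothesis R*); Hooley's 1976 Cambridge tract = book:hooley1987-applications-sieve-methods-theory-numbers-primeneniya-metodov pp.39–40, HeathBrown2001LargestPrimeFactorCubic = doi:10.1112/plms/82.3.554, Thm 2 (q-analogue of van der Corput needs q = q₀…q_k suitably factorable) and p.2 ('no such bound is currently available'), Welsh2018CubicCongruenceSpacing = arXiv:1809.05211 p.4 (Hooley 1978 parametrisation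 re-derived; no route to the Weyl sum), MarklofWelsh2023 = arXiv:2105.02854 p.4 (power saving in print only for deg 2, Hooley 1963/Bykovskii via Weil), KowalskiSoundararajan2021 §2 Ex. 1 p.7 (best printed deg ≥ 3 discrepancy ≪ (log x)^{-1/(8·d!)}; CRT mixing gives no rate)
[crux] Hooley with a power saving for cubics: ∀ f irreducible of degree 3, ∀ h ≠ 0, ∃ δ > 0: ∑_{d ≤
D} ∑_{ν mod d, f(ν) ≡ 0 (d)} e(hν/d) = O(D^{1−δ}) (∑_{d≤D} ω_f(d) ≍ D). Hooley1964 proves o(D) with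
a (log D)^{-δ_f} saving for every irreducible f of degree ≥ 2 (power saving only for quadratics, via
Weil/Kloosterman); KowalskiSoundararajan2021 re-prove and generalise the qualitative statement by
CRT mixing. A power saving is what a spectral-gap / effective-mixing proof on the cubic torus orbit
would deliver. Believed open for deg 3 — grounders to confirm. -/
@[route_item "route-Parity-CubicRoots"]
def CubicHooleyPowerSaving : Prop :=
  ∀ f : Polynomial ℤ, f.natDegree = 3 → Irreducible f → ∀ h : ℤ, h ≠ 0 → ∃ δ : ℝ, 0 < δ ∧ (fun D : ℕ => ∑ d ∈ Finset.Icc 1 D, ∑ ν ∈ (Finset.range d).filter (fun ν : ℕ => (d : ℤ) ∣ f.eval (ν : ℤ)), Complex.exp (2 * Real.pi * Complex.I * (h * ν / d : ℂ))) =O[Filter.atTop] fun D : ℕ => ((D : ℝ) ^ (1 - δ) : ℝ)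

/-- item stmt-Parity-0880 · target · rank 5 · closed · moot by None · by planner
why it might fail: = thesis X_CR: given TypeIMainTerm it is EQUIVALENT to Σ_{n≤x}Λ(f(n)) ~ C(f)x, i.e. cubic BH in Λ-form (refuters g28-1/3/5/6): a reformulation, not a reduction; false iff BH fails for a cubic. Ford 2004/Bombieri 1976: no Type-I level <1 decides it; reached only via r2–r4 + undecomposed Type-II step.
sources: Literature.Barriers.Parity.FordFixedLevelBarrier (Ford2004 Thm 1) and Literature.NumberTheory.Sieve.bombieri_asymptotic_sieve_indeterminacy_holds (BombieriAsymptoticSieve1976; tree), stmt-Parity-0870 = PolynomialMobius.PolyMobiusTail (general k, deg; CubicMobiusTail ← PolyMobiusTail by Fin 1 glue, one direction), Mathlib ArithmeticFunction.sum_moebius_mul_log_eq (Λ = −Σ_{d|m} μ(d) log d: the identity making X_CR ⟺ Λ-form BH given 0873), Welsh2022 = arXiv:2008.00538 p.3; KowalskiSoundararajan2021 = arXiv:2003.12965 p.3 (no input beyond qualitative root equidistribution for deg 3)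
[crux] X_CR, the cubic Möbius tail (= PolynomialMobius.PolyMobiusTail at k = 1, deg f = 3, filed
separately so the cubic Assembly is self-contained): ∀ cubic BH f ∃ η ∈ (0,1): ∑_{n≤x} ∑_{d | f(n),
d > x^{1−η}} μ(d) log d = o(x). Decomposes into the window d ∈ [x^{1−η}, x^{3/2}] (μ(d) against
small-root counts A_d(x): inputs r3, r4 and their joint fine-scale versions) and the cofactor side e
= f(n)/d ≤ x^{3/2} (Möbius of the large cofactor along roots mod e; balanced part = r2). Open. -/
@[route_item "route-Parity-CubicRoots"]
def CubicMobiusTail : Prop :=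
  ∀ f : Polynomial ℤ, f.natDegree = 3 → Literature.NumberTheory.Sieve.IsBatemanHornSystem ![f] → ∃ η : ℝ, 0 < η ∧ η < 1 ∧ (fun x : ℕ => ∑ n ∈ Finset.Icc 1 x, ∑ d ∈ ((f.eval (n : ℤ)).toNat).divisors, if (x : ℝ) ^ (1 - η) < (d : ℝ) then (ArithmeticFunction.moebius d : ℝ) * Real.log d else 0) =o[Filter.atTop] fun x : ℕ => (x : ℝ)

/-- item stmt-Parity-0873 · support · rank 9 · open · by planner
[support] Type-I main term, theorem-grade: for every BH system f and η ∈ (0,1) there is C with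
HasBatemanHornConst f C and (−1)^k ∑_{n≤x} ∑_{d_i | f_i(n), d_1⋯d_k ≤ x^{1−η}} ∏ μ(d_i) log d_i ~
C·x. Proof sketch: #{n ≤ x : d_i | f_i(n) ∀ i} = x ρ(d)/lcm(d) + O(ρ(d)) (period lcm(d) ≤ x^{1−η});
the log-weighted singular series (−1)^k ∑_d ∏(μ(d_i) log d_i) ρ(d)/lcm(d) converges (ordered by the
cutoff) to the Bateman–Horn constant C(f) = ∏_p (1−1/p)^{−k}(1−ω(p)/p) by the prime ideal theorem
with error term in the splitting fields (Landau1903; BatemanHorn1962 §2; DavenportSchinzel1966; k =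
1, f = X: −∑ μ(d) log d/d = 1). Named fact available:
Literature.NumberTheory.Sieve.exists_hasBatemanHornConst. Provable with substantial effort;
grounders may propose the needed Dedekind-zeta facts as Literature cites. -/
@[route_item "route-Parity-CubicRoots"]
def TypeIMainTerm : Prop :=
  ∀ (k : ℕ) (f : Fin k → Polynomial ℤ), Literature.NumberTheory.Sieve.IsBatemanHornSystem f → ∀ η : ℝ, 0 < η → η < 1 → ∃ C : ℝ, 0 < C ∧ Literature.NumberTheory.Sieve.HasBatemanHornConst f C ∧ Asymptotics.IsEquivalent Filter.atTop (fun x : ℕ => (-1 : ℝ) ^ k * ∑ n ∈ Finset.Icc 1 x, ∑ d ∈ Fintype.piFinset (fun i => (((f i).eval (n : ℤ)).toNat).divisors), if ∏ i, (d i : ℝ) ≤ (x : ℝ) ^ (1 - η) then ∏ i, ((ArithmeticFunction.moebius (d i) : ℝ) * Real.log (d i)) else 0) (fun x : ℕ => C * (x : ℝ))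

/-- item stmt-Parity-0874 · support · rank 9 · open · by planner
[support] From Λ-weights to the count, theorem-grade: if ∑_{n≤x} ∏_i Λ(f_i(n)) ~ C·x with
HasBatemanHornConst f C then BatemanHornAsymptotic f (polyPrimeCount f x ~ C/(∏ deg f_i) · x/(log
x)^k). Partial summation (Λ(f_i(n)) = log f_i(n) = deg f_i · log n + O(1) at prime values) plus
negligibility of proper prime-power values f_i(n) = p^a, a ≥ 2: O(x^{1/2+ε}) — trivial for deg ≤ 2,
Bombieri–Pila / Siegel integral points on y^a = f_i(x) for deg ≥ 3. C > 0 by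
Literature.NumberTheory.Sieve.exists_hasBatemanHornConst. -/
@[route_item "route-Parity-CubicRoots"]
def LambdaToCount : Prop :=
  ∀ (k : ℕ) (f : Fin k → Polynomial ℤ), Literature.NumberTheory.Sieve.IsBatemanHornSystem f → ∀ C : ℝ, 0 < C → Literature.NumberTheory.Sieve.HasBatemanHornConst f C → Asymptotics.IsEquivalent Filter.atTop (fun x : ℕ => ∑ n ∈ Finset.Icc 1 x, ∏ i, ArithmeticFunction.vonMangoldt (((f i).eval (n : ℤ)).toNat)) (fun x : ℕ => C * (x : ℝ)) → Literature.NumberTheory.Sieve.BatemanHornAsymptotic f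

/-- item stmt-Parity-0881 · assembly · rank 1 · closed · moot by None · by planner
[assembly] CubicMobiusTail → TypeIMainTerm → LambdaToCount → CubicBH: for f cubic with
IsBatemanHornSystem ![f], specialise the two supports to k = 1, f = ![f] (Fintype.piFinset over Fin
1 ≃ divisors; ∏ over Fin 1 = the single factor), use Λ(f(n)) = −∑_{d|f(n)} μ(d) log d (Mathlib
ArithmeticFunction.sum_moebius_mul_log_eq), split at d ≤ x^{1−η}, add. Provable now (bookkeeping). -/
@[route_item "route-Parity-CubicRoots"]
def Assembly : Prop :=
  CubicMobiusTail → TypeIMainTerm → LambdaToCount → CubicBH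

end Summit.Parity.BatemanHorn.Theses.CubicRoots
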